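import Summits.Schanuel.Schanuel.Theorems.RootDecomp1HSubst

/-!
# RootDecomp1HTwistCells — TWIST31 presentations ported through `cell_clean_of_substExcl` (the vesting condition of the critic's
# VERDICT 2026-08-30T17:24:08Z on kit K13 TWIST31; census seat decomp-schanuel-census-1 gen 8)

For each of the clean (ℚ-free, non-hull) Krawczyk-certified twisted σ-stable points of cell (3,1) listed below (census/TWIST31-v1.json,
`clean_first120`, kit j340978) ONE system through the point is ported in the K10 `CyclesCell` / `TwistB0` pattern: the three size-1 forms
`twL`, the UNIMODULAR pivot substitution `twG` recorded in the table (pivot columns / free columns as certified), the integral ideal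
coefficients `twCoef = M⁻¹`, the identity `hid` by `ring`, and `cell_clean` = `RootDecomp1HSubst.cell_clean_of_substExcl` under ARBITRARY
binders (so it serves FinCS 27287 AND FinCSSigma 26888). The numerical half — `SubstExcl (aeval twG) y 4` at the certified point, i.e.
no integer polynomial of degree ≤ 4 and Euclidean norm ≤ H_cert ≥ 10²¹ (> √35·H₀) in the three free coordinates — is the census FACT of
TWIST31-v1 (presentation recorded per point), exactly as K10/K11 left `SrcExcl`/`EuclExcl` instances to the census table.

Sorry-free; standard axioms; `--supports stmt-Schanuel-27287`. Nothing here proves Schanuel; rung 0.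
-/

set_option linter.dupNamespace false

noncomputable section

namespace Summit.Schanuel.Schanuel.Theorems.RootDecomp1HSubst

open Complex Set
open Literature.NumberTheory.Transcendental (SchanuelRank)
open Summit.Schanuel.Schanuel.Theses.RootDecomp1H (ProductSchanuel RelTowerSchanuel BridgeTransverse FinCS)
open Summit.Schanuel.Schanuel.Theorems.RootDecomp1HClearance (LowerRanks CounterEx InTowerHull
  towerTuple_of_counterEx_rank_le_two)
open Summit.Schanuel.Schanuel.Theorems.RootDecomp1HHull (not_lt_of_inTowerHull)
open Summit.Schanuel.Schanuel.Theorems.RootDecomp1HGauge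

variable {n : ℕ}

/-! ## 1. point pid 2696 (family A, P2): `y = (s+it, s−it, x)`, `s = -0.6897953901473023687…`, `t = 0.14176481206293044279…`, `x = 0.31691268993397338666…`
system `-y1-y3+e^y1-e^y2-e^y3+1 ∣ -y2-y3-e^y1+e^y2-e^y3+1 ∣ y1+y2-e^y1-e^y2+e^y3+1`; pivot columns ['X1', 'X2', 'Y3'] (det -1), free ['X3', 'Y1', 'Y2']; TWIST31 EXCL(4): H₀ = 2016840, log₁₀ H_cert = 21.46 (CERTIFIED). -/
namespace TwistA2696

open MvPolynomial (X C aeval) in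
/-- The three forms of the system through point 2696. -/
noncomputable def twL : Fin 3 → QPoly 3 :=
  ![-X (Sum.inl 0) - X (Sum.inl 2) + X (Sum.inr 0) - X (Sum.inr 1) - X (Sum.inr 2) + 1,
    -X (Sum.inl 1) - X (Sum.inl 2) - X (Sum.inr 0) + X (Sum.inr 1) - X (Sum.inr 2) + 1,
    X (Sum.inl 0) + X (Sum.inl 1) - X (Sum.inr 0) - X (Sum.inr 1) + X (Sum.inr 2) + 1]

open MvPolynomial (X C aeval) in
/-- The recorded unimodular pivot substitution (pivots ['X1', 'X2', 'Y3']; free ['X3', 'Y1', 'Y2']). -/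
noncomputable def twG : Fin 3 ⊕ Fin 3 → QPoly 3 :=
  Sum.elim ![X (Sum.inl 2) + 2 * X (Sum.inr 0) - 2, X (Sum.inl 2) + 2 * X (Sum.inr 1) - 2, X (Sum.inl 2)]
    ![X (Sum.inr 0), X (Sum.inr 1), -2 * X (Sum.inl 2) - X (Sum.inr 0) - X (Sum.inr 1) + 3]

/-- The integral ideal coefficients `M⁻¹` (zero rows at the free columns). -/
noncomputable def twCoef : Fin 3 ⊕ Fin 3 → Fin 3 → QPoly 3 :=
  Sum.elim ![![0, 1, 1], ![1, 0, 1], ![0, 0, 0]] ![![0, 0, 0], ![0, 0, 0], ![-1, -1, -1]]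

/-- `∀ s, X s − twG s = ∑ k, twCoef s k * twL k`. -/
theorem hid : ∀ s, MvPolynomial.X s - twG s = ∑ k, twCoef s k * twL k := by
  rintro (i | i) <;> fin_cases i <;> simp [twG, twCoef, twL, Fin.sum_univ_three] <;> ring

/-- `AlongForms` for this system at any of its zeros. -/
theorem alongForms {y : Fin 3 → ℂ} (hy : ∀ k, MvPolynomial.aeval (pt y) (twL k) = 0) :
    AlongForms twL (MvPolynomial.aeval twG) y :=
  alongForms_of_coeffs twL twG twCoef hid hy

/-- The zero condition in analytic form. -/
theorem zeros_of_eqs {y : Fin 3 → ℂ} (h₁ : -y 0 - y 2 + cexp (y 0) - cexp (y 1) - cexp (y 2) + 1 = 0)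
    (h₂ : -y 1 - y 2 - cexp (y 0) + cexp (y 1) - cexp (y 2) + 1 = 0)
    (h₃ : y 0 + y 1 - cexp (y 0) - cexp (y 1) + cexp (y 2) + 1 = 0) :
    ∀ k, MvPolynomial.aeval (pt y) (twL k) = 0 := by
  intro k
  fin_cases k <;> simpa [twL, pt] using by assumption

/-- THE CELL INSTANCE of this system at any zero `y` (in particular the certified point 2696), from the census fact `SubstExcl (aeval twG) y N`, under ANY binders. -/
theorem cell_clean {y : Fin 3 → ℂ} (h₁ : -y 0 - y 2 + cexp (y 0) - cexp (y 1) - cexp (y 2) + 1 = 0)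
    (h₂ : -y 1 - y 2 - cexp (y 0) + cexp (y 1) - cexp (y 2) + 1 = 0)
    (h₃ : y 0 + y 1 - cexp (y 0) - cexp (y 1) + cexp (y 2) + 1 = 0) {N : ℕ}
    (hex : SubstExcl (MvPolynomial.aeval twG) y N) (H₁ H₂ H₃ : Prop) :
    H₁ → H₂ → H₃ →
      (¬ LinearIndependent ℚ y ∨
        ¬ ∃ P : Fin (3 + 1) → MvPolynomial (Fin 3 ⊕ Fin 3) ℤ, (∀ i, psize (P i) ≤ N) ∧ IsCertificate 3 y P) :=
  cell_clean_of_substExcl (alongForms (zeros_of_eqs h₁ h₂ h₃)) hex H₁ H₂ H₃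

end TwistA2696

/-! ## 2. point pid 2744 (family A, P2): `y = (s+it, s−it, x)`, `s = -0.6826162145422684291…`, `t = 0.25110304945849971208…`, `x = 0.97889353788290240993…`
system `-y1+y3+e^y1-e^y2-e^y3+1 ∣ -y2+y3-e^y1+e^y2-e^y3+1 ∣ y3-e^y1-e^y2`; pivot columns ['X1', 'X2', 'X3'] (det 1), free ['Y1', 'Y2', 'Y3']; TWIST31 EXCL(4): H₀ = 215040, log₁₀ H_cert = 21.5 (CERTIFIED). -/
namespace TwistA2744

open MvPolynomial (X C aeval) in
/-- The three forms of the system through point 2744. -/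
noncomputable def twL : Fin 3 → QPoly 3 :=
  ![-X (Sum.inl 0) + X (Sum.inl 2) + X (Sum.inr 0) - X (Sum.inr 1) - X (Sum.inr 2) + 1,
    -X (Sum.inl 1) + X (Sum.inl 2) - X (Sum.inr 0) + X (Sum.inr 1) - X (Sum.inr 2) + 1,
    X (Sum.inl 2) - X (Sum.inr 0) - X (Sum.inr 1)]

open MvPolynomial (X C aeval) in
/-- The recorded unimodular pivot substitution (pivots ['X1', 'X2', 'X3']; free ['Y1', 'Y2', 'Y3']). -/
noncomputable def twG : Fin 3 ⊕ Fin 3 → QPoly 3 :=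
  Sum.elim ![2 * X (Sum.inr 0) - X (Sum.inr 2) + 1, 2 * X (Sum.inr 1) - X (Sum.inr 2) + 1, X (Sum.inr 0) + X (Sum.inr 1)]
    ![X (Sum.inr 0), X (Sum.inr 1), X (Sum.inr 2)]

/-- The integral ideal coefficients `M⁻¹` (zero rows at the free columns). -/
noncomputable def twCoef : Fin 3 ⊕ Fin 3 → Fin 3 → QPoly 3 :=
  Sum.elim ![![-1, 0, 1], ![0, -1, 1], ![0, 0, 1]] ![![0, 0, 0], ![0, 0, 0], ![0, 0, 0]]

/-- `∀ s, X s − twG s = ∑ k, twCoef s k * twL k`. -/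
theorem hid : ∀ s, MvPolynomial.X s - twG s = ∑ k, twCoef s k * twL k := by
  rintro (i | i) <;> fin_cases i <;> simp [twG, twCoef, twL, Fin.sum_univ_three] <;> ring

/-- `AlongForms` for this system at any of its zeros. -/
theorem alongForms {y : Fin 3 → ℂ} (hy : ∀ k, MvPolynomial.aeval (pt y) (twL k) = 0) :
    AlongForms twL (MvPolynomial.aeval twG) y :=
  alongForms_of_coeffs twL twG twCoef hid hy

/-- The zero condition in analytic form. -/
theorem zeros_of_eqs {y : Fin 3 → ℂ} (h₁ : -y 0 + y 2 + cexp (y 0) - cexp (y 1) - cexp (y 2) + 1 = 0)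
    (h₂ : -y 1 + y 2 - cexp (y 0) + cexp (y 1) - cexp (y 2) + 1 = 0)
    (h₃ : y 2 - cexp (y 0) - cexp (y 1) = 0) :
    ∀ k, MvPolynomial.aeval (pt y) (twL k) = 0 := by
  intro k
  fin_cases k <;> simpa [twL, pt] using by assumption

/-- THE CELL INSTANCE of this system at any zero `y` (in particular the certified point 2744), from the census fact `SubstExcl (aeval twG) y N`, under ANY binders. -/
theorem cell_clean {y : Fin 3 → ℂ} (h₁ : -y 0 + y 2 + cexp (y 0) - cexp (y 1) - cexp (y 2) + 1 = 0)
    (h₂ : -y 1 + y 2 - cexp (y 0) + cexp (y 1) - cexp (y 2) + 1 = 0)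
    (h₃ : y 2 - cexp (y 0) - cexp (y 1) = 0) {N : ℕ}
    (hex : SubstExcl (MvPolynomial.aeval twG) y N) (H₁ H₂ H₃ : Prop) :
    H₁ → H₂ → H₃ →
      (¬ LinearIndependent ℚ y ∨
        ¬ ∃ P : Fin (3 + 1) → MvPolynomial (Fin 3 ⊕ Fin 3) ℤ, (∀ i, psize (P i) ≤ N) ∧ IsCertificate 3 y P) :=
  cell_clean_of_substExcl (alongForms (zeros_of_eqs h₁ h₂ h₃)) hex H₁ H₂ H₃

end TwistA2744

/-! ## 3. point pid 2762 (family A, P2): `y = (s+it, s−it, x)`, `s = -0.6795197285430556749…`, `t = 0.28555546116869693145…`, `x = -0.3863690119006327941…`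
system `-y1+e^y1-e^y2-e^y3 ∣ -y2-e^y1+e^y2-e^y3 ∣ y1+y2-y3+e^y1+e^y2`; pivot columns ['X1', 'X2', 'X3'] (det -1), free ['Y1', 'Y2', 'Y3']; TWIST31 EXCL(4): H₀ = 215040, log₁₀ H_cert = 21.46 (CERTIFIED). -/
namespace TwistA2762

open MvPolynomial (X C aeval) in
/-- The three forms of the system through point 2762. -/
noncomputable def twL : Fin 3 → QPoly 3 :=
  ![-X (Sum.inl 0) + X (Sum.inr 0) - X (Sum.inr 1) - X (Sum.inr 2),
    -X (Sum.inl 1) - X (Sum.inr 0) + X (Sum.inr 1) - X (Sum.inr 2),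
    X (Sum.inl 0) + X (Sum.inl 1) - X (Sum.inl 2) + X (Sum.inr 0) + X (Sum.inr 1)]

open MvPolynomial (X C aeval) in
/-- The recorded unimodular pivot substitution (pivots ['X1', 'X2', 'X3']; free ['Y1', 'Y2', 'Y3']). -/
noncomputable def twG : Fin 3 ⊕ Fin 3 → QPoly 3 :=
  Sum.elim ![X (Sum.inr 0) - X (Sum.inr 1) - X (Sum.inr 2), -X (Sum.inr 0) + X (Sum.inr 1) - X (Sum.inr 2), X (Sum.inr 0) + X (Sum.inr 1) - 2 * X (Sum.inr 2)]
    ![X (Sum.inr 0), X (Sum.inr 1), X (Sum.inr 2)]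

/-- The integral ideal coefficients `M⁻¹` (zero rows at the free columns). -/
noncomputable def twCoef : Fin 3 ⊕ Fin 3 → Fin 3 → QPoly 3 :=
  Sum.elim ![![-1, 0, 0], ![0, -1, 0], ![-1, -1, -1]] ![![0, 0, 0], ![0, 0, 0], ![0, 0, 0]]

/-- `∀ s, X s − twG s = ∑ k, twCoef s k * twL k`. -/
theorem hid : ∀ s, MvPolynomial.X s - twG s = ∑ k, twCoef s k * twL k := by
  rintro (i | i) <;> fin_cases i <;> simp [twG, twCoef, twL, Fin.sum_univ_three] <;> ring

/-- `AlongForms` for this system at any of its zeros. -/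
theorem alongForms {y : Fin 3 → ℂ} (hy : ∀ k, MvPolynomial.aeval (pt y) (twL k) = 0) :
    AlongForms twL (MvPolynomial.aeval twG) y :=
  alongForms_of_coeffs twL twG twCoef hid hy

/-- The zero condition in analytic form. -/
theorem zeros_of_eqs {y : Fin 3 → ℂ} (h₁ : -y 0 + cexp (y 0) - cexp (y 1) - cexp (y 2) = 0)
    (h₂ : -y 1 - cexp (y 0) + cexp (y 1) - cexp (y 2) = 0)
    (h₃ : y 0 + y 1 - y 2 + cexp (y 0) + cexp (y 1) = 0) :
    ∀ k, MvPolynomial.aeval (pt y) (twL k) = 0 := by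
  intro k
  fin_cases k <;> simpa [twL, pt] using by assumption

/-- THE CELL INSTANCE of this system at any zero `y` (in particular the certified point 2762), from the census fact `SubstExcl (aeval twG) y N`, under ANY binders. -/
theorem cell_clean {y : Fin 3 → ℂ} (h₁ : -y 0 + cexp (y 0) - cexp (y 1) - cexp (y 2) = 0)
    (h₂ : -y 1 - cexp (y 0) + cexp (y 1) - cexp (y 2) = 0)
    (h₃ : y 0 + y 1 - y 2 + cexp (y 0) + cexp (y 1) = 0) {N : ℕ}
    (hex : SubstExcl (MvPolynomial.aeval twG) y N) (H₁ H₂ H₃ : Prop) :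
    H₁ → H₂ → H₃ →
      (¬ LinearIndependent ℚ y ∨
        ¬ ∃ P : Fin (3 + 1) → MvPolynomial (Fin 3 ⊕ Fin 3) ℤ, (∀ i, psize (P i) ≤ N) ∧ IsCertificate 3 y P) :=
  cell_clean_of_substExcl (alongForms (zeros_of_eqs h₁ h₂ h₃)) hex H₁ H₂ H₃

end TwistA2762

/-! ## 4. point pid 2848 (family A, P2): `y = (s+it, s−it, x)`, `s = -0.6718737547423943337…`, `t = 0.35650765340456175086…`, `x = -1.0291752708177533037…`
system `-y1+y3+e^y1-e^y2+e^y3 ∣ -y2+y3-e^y1+e^y2+e^y3 ∣ y1+y2-y3+e^y1+e^y2+e^y3-1`; pivot columns ['X1', 'X2', 'X3'] (det 1), free ['Y1', 'Y2', 'Y3']; TWIST31 EXCL(4): H₀ = 1088640, log₁₀ H_cert = 21.46 (CERTIFIED). -/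
namespace TwistA2848

open MvPolynomial (X C aeval) in
/-- The three forms of the system through point 2848. -/
noncomputable def twL : Fin 3 → QPoly 3 :=
  ![-X (Sum.inl 0) + X (Sum.inl 2) + X (Sum.inr 0) - X (Sum.inr 1) + X (Sum.inr 2),
    -X (Sum.inl 1) + X (Sum.inl 2) - X (Sum.inr 0) + X (Sum.inr 1) + X (Sum.inr 2),
    X (Sum.inl 0) + X (Sum.inl 1) - X (Sum.inl 2) + X (Sum.inr 0) + X (Sum.inr 1) + X (Sum.inr 2) - 1]

open MvPolynomial (X C aeval) in
/-- The recorded unimodular pivot substitution (pivots ['X1', 'X2', 'X3']; free ['Y1', 'Y2', 'Y3']). -/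
noncomputable def twG : Fin 3 ⊕ Fin 3 → QPoly 3 :=
  Sum.elim ![-2 * X (Sum.inr 1) - 2 * X (Sum.inr 2) + 1, -2 * X (Sum.inr 0) - 2 * X (Sum.inr 2) + 1, -X (Sum.inr 0) - X (Sum.inr 1) - 3 * X (Sum.inr 2) + 1]
    ![X (Sum.inr 0), X (Sum.inr 1), X (Sum.inr 2)]

/-- The integral ideal coefficients `M⁻¹` (zero rows at the free columns). -/
noncomputable def twCoef : Fin 3 ⊕ Fin 3 → Fin 3 → QPoly 3 :=
  Sum.elim ![![0, 1, 1], ![1, 0, 1], ![1, 1, 1]] ![![0, 0, 0], ![0, 0, 0], ![0, 0, 0]]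

/-- `∀ s, X s − twG s = ∑ k, twCoef s k * twL k`. -/
theorem hid : ∀ s, MvPolynomial.X s - twG s = ∑ k, twCoef s k * twL k := by
  rintro (i | i) <;> fin_cases i <;> simp [twG, twCoef, twL, Fin.sum_univ_three] <;> ring

/-- `AlongForms` for this system at any of its zeros. -/
theorem alongForms {y : Fin 3 → ℂ} (hy : ∀ k, MvPolynomial.aeval (pt y) (twL k) = 0) :
    AlongForms twL (MvPolynomial.aeval twG) y :=
  alongForms_of_coeffs twL twG twCoef hid hy

/-- The zero condition in analytic form. -/
theorem zeros_of_eqs {y : Fin 3 → ℂ} (h₁ : -y 0 + y 2 + cexp (y 0) - cexp (y 1) + cexp (y 2) = 0)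
    (h₂ : -y 1 + y 2 - cexp (y 0) + cexp (y 1) + cexp (y 2) = 0)
    (h₃ : y 0 + y 1 - y 2 + cexp (y 0) + cexp (y 1) + cexp (y 2) - 1 = 0) :
    ∀ k, MvPolynomial.aeval (pt y) (twL k) = 0 := by
  intro k
  fin_cases k <;> simpa [twL, pt] using by assumption

/-- THE CELL INSTANCE of this system at any zero `y` (in particular the certified point 2848), from the census fact `SubstExcl (aeval twG) y N`, under ANY binders. -/
theorem cell_clean {y : Fin 3 → ℂ} (h₁ : -y 0 + y 2 + cexp (y 0) - cexp (y 1) + cexp (y 2) = 0)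
    (h₂ : -y 1 + y 2 - cexp (y 0) + cexp (y 1) + cexp (y 2) = 0)
    (h₃ : y 0 + y 1 - y 2 + cexp (y 0) + cexp (y 1) + cexp (y 2) - 1 = 0) {N : ℕ}
    (hex : SubstExcl (MvPolynomial.aeval twG) y N) (H₁ H₂ H₃ : Prop) :
    H₁ → H₂ → H₃ →
      (¬ LinearIndependent ℚ y ∨
        ¬ ∃ P : Fin (3 + 1) → MvPolynomial (Fin 3 ⊕ Fin 3) ℤ, (∀ i, psize (P i) ≤ N) ∧ IsCertificate 3 y P) :=
  cell_clean_of_substExcl (alongForms (zeros_of_eqs h₁ h₂ h₃)) hex H₁ H₂ H₃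

end TwistA2848

end Summit.Schanuel.Schanuel.Theorems.RootDecomp1HSubst
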